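import Mathlib
import HarnessLib
import Literature.Computability.Complexity.KannanLanguage
import Literature.Computability.MetaComplexity.Magnification

/-!
# Block-product (fooling) lemma for one-pass streaming algorithms (`stub_blockProduct`)

Route `UniformStream`, crux `UniformStreamLB` (stmt-PneNP-16045), line `birth`: the registered stub
`stub_blockProduct` (`--supports stmt-PneNP-16045`), the generic combinatorial heart of the
calibration of the LOW levels of the crux (one-pass streaming lower bounds for `MCSP[n ↦ n]` by a
fooling-set count): the crossing-sequence / pigeonhole argument for ONE-PASS algorithms
(`Literature.Computability.MetaComplexity.StreamingAlgorithm`, `Magnification.lean`).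

**Theorem (`stub_blockProduct`).** Let `A` be a one-pass streaming algorithm with space bound `S`
deciding `L`, let `B ≥ 1`, and let `W` be a finite set of blocks, all of length `ℓ`, such that
every constant word `w^B = w w ⋯ w` (`w ∈ W`; input length `N = B·ℓ`) lies in `L`. Then there is
`T ⊆ W` with `|W| ≤ |T| · 2^{(S N + 1)(B - 1)}` all of whose MIXED words `w₀ w₁ ⋯ w_{B-1}`
(`wᵢ ∈ T`) lie in `L`.

*Proof (crossing sequences + pigeonhole).* For `w ∈ W` let `q_i(w)` be the state of `A` (run at
input length `N`) after reading `w^i`; so `q_{i+1}(w)` is reached from `q_i(w)` by reading one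
more block `w`, and `|q_i(w)| ≤ S N` (`length_runFrom_le`). A bit string of length `≤ S N` is
coded INJECTIVELY by a point of `{0,1}^{S N + 1}` (its bits, then a `1` at position `|st|`, then
`0`s: the tree's padding code `Kannan.code` / `Kannan.code_injective` of `KannanLanguage.lean`),
so the signature `σ(w) = (code q_1(w), …, code q_{B-1}(w)) ∈ ({0,1}^{S N+1})^{B-1}` takes at
most `2^{(S N+1)(B-1)}` values (`Fintype.card_fun`). Let `T` be a largest fibre of `σ` on `W`
(`Finset.exists_max_image`); then `|W| ≤ |T| · 2^{(S N+1)(B-1)}`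
(`Finset.card_le_mul_card_image_of_maps_to`), and on `T` all boundary states agree:
`q_i(v) = q_i(w)` for `v, w ∈ T`, `1 ≤ i ≤ B - 1` (injectivity of the code). By induction on
the number `i ≤ B` of blocks read (lists `ws ++ [w]` over `T`, `List.reverseRecOn`), after
reading the first `i` blocks `w₀ ⋯ w_{i-1}` of a mixed word over `T` the algorithm is in state
`q_i(w_{i-1})`: by induction it was in `q_{i-1}(w_{i-2}) = q_{i-1}(w_{i-1})` (agreement, as
`1 ≤ i-1 ≤ B-1`), and one more block `w_{i-1}` leads to `q_i(w_{i-1})`. Hence the final state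
on the mixed word (length `B·ℓ = N`) is `q_B(w_{B-1})`, the final state on the constant word
`w_{B-1}^B ∈ L` (same length `N`), which is accepting since `A` decides `L`; so the mixed word is
accepted, i.e. lies in `L`. [folklore: the crossing-sequence method (Hennie 1965) specialised to
one-pass machines; cf. McKay–Murray–Williams 2019, §2 for the streaming model]

## References

* D. M. McKay, C. D. Murray, R. R. Williams, *Weak lower bounds on resource-bounded compression
  imply strong separations of complexity classes*, STOC 2019, §2 (one-pass streaming model).
  [MckayMurrayWilliams2019]
* F. C. Hennie, *One-tape, off-line Turing machine computations*, Information and Control 8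
  (1965), 553–578 (crossing sequences). [folklore]
-/

set_option linter.dupNamespace false -- `Summit.PneNP.PneNP.…`: summit = sub-problem (D-0017)

noncomputable section

namespace Summit.PneNP.PneNP.Theorems.UniformStreamLB.Birth

open Literature.Computability.Complexity Literature.Computability.MetaComplexity

namespace BlockProduct

/-- Reading a concatenation `x ++ y` = reading `y` from the state reached on `x`. [folklore] -/
theorem runFrom_append (A : StreamingAlgorithm) (N : ℕ) (st x y : List Bool) :
    A.runFrom N st (x ++ y) = A.runFrom N (A.runFrom N st x) y := by
  unfold StreamingAlgorithm.runFrom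
  exact List.foldl_append

/-- A concatenation of blocks of common length `ℓ` has length (number of blocks) `· ℓ`.
[folklore] -/
theorem length_flatten_of_forall_length_eq {ℓ : ℕ} :
    ∀ ws : List (List Bool), (∀ w ∈ ws, w.length = ℓ) → ws.flatten.length = ws.length * ℓ
  | [], _ => by simp
  | w :: ws, h => by
    rw [List.flatten_cons, List.length_append, List.length_cons, h w (by simp),
      length_flatten_of_forall_length_eq ws fun v hv => h v (by simp [hv])]
    ring

end BlockProduct

open BlockProduct in
/-- **Block-product (fooling) lemma for one-pass streaming algorithms** (registered stub
`stub_blockProduct` of line `birth`, crux `UniformStreamLB`). If a streaming algorithm `A` with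
space `S` decides `L`, `B ≥ 1`, and every `B`-fold repetition `w^B` of a block `w ∈ W` (all blocks
of length `ℓ`) lies in `L`, then some `T ⊆ W` with `|W| ≤ |T| · 2^{(S(Bℓ)+1)(B-1)}` has ALL its
mixed words `w₀ w₁ ⋯ w_{B-1}` (`wᵢ ∈ T`) in `L`: pigeonhole on the signature of the `B - 1`
boundary states of the runs on the constant words (each a bit string of length `≤ S(Bℓ)`, coded
in `{0,1}^{S(Bℓ)+1}` by `Kannan.code`), then a crossing-sequence induction along the blocks of a
mixed word. [folklore] -/
theorem stub_blockProduct (A : StreamingAlgorithm) (S : ℕ → ℕ) (hS : A.HasSpace S)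
    (L : Language Bool) (hL : A.Decides L) (B ℓ : ℕ) (hB : 1 ≤ B)
    (W : Finset (List Bool)) (hW : ∀ w ∈ W, w.length = ℓ)
    (hconst : ∀ w ∈ W, (List.replicate B w).flatten ∈ L) :
    ∃ T : Finset (List Bool), T ⊆ W ∧ W.card ≤ T.card * 2 ^ ((S (B * ℓ) + 1) * (B - 1)) ∧
      ∀ f : Fin B → List Bool, (∀ i, f i ∈ T) → (List.ofFn f).flatten ∈ L := by
  obtain ⟨B', rfl⟩ : ∃ B', B = B' + 1 := ⟨B - 1, by omega⟩
  rw [Nat.add_sub_cancel]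
  -- the input length `N` and the boundary states `q i w` = state after reading `w^i`
  set N : ℕ := (B' + 1) * ℓ with hN
  obtain ⟨q, hq⟩ : ∃ q : ℕ → List Bool → List Bool,
      ∀ i w, q i w = A.runFrom N (A.init N) (List.replicate i w).flatten := ⟨_, fun _ _ => rfl⟩
  have hq_succ : ∀ i w, q (i + 1) w = A.runFrom N (q i w) w := by
    intro i w
    rw [hq, hq, List.replicate_succ', List.flatten_append, List.flatten_singleton, runFrom_append]
  have hq_len : ∀ i w, (q i w).length ≤ S N := fun i w => by
    rw [hq]
    exact A.length_runFrom_le hS N (hS N).1 _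
  -- the signature of a block: the codes of its `B'` boundary states
  obtain ⟨σ, hσ⟩ : ∃ σ : List Bool → Fin B' → Fin (S N + 1) → Bool,
      ∀ w i, σ w i = Kannan.code (S N) (q ((i : ℕ) + 1) w) := ⟨_, fun _ _ => rfl⟩
  -- a largest fibre of `σ` on `W`
  obtain ⟨y₀, -, hy₀⟩ :=
    Finset.exists_max_image (Finset.univ : Finset (Fin B' → Fin (S N + 1) → Bool))
      (fun y => (W.filter fun w => σ w = y).card) Finset.univ_nonempty
  set T : Finset (List Bool) := W.filter fun w => σ w = y₀ with hT
  have hTW : T ⊆ W := Finset.filter_subset _ _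
  refine ⟨T, hTW, ?_, ?_⟩
  · -- counting: `W` is covered by the `2^((S N + 1) B')` fibres of `σ`, each of size `≤ |T|`
    have hcount :
        W.card ≤ T.card * (Finset.univ : Finset (Fin B' → Fin (S N + 1) → Bool)).card :=
      Finset.card_le_mul_card_image_of_maps_to (f := σ) (fun w _ => Finset.mem_univ _) T.card
        fun y _ => hy₀ y (Finset.mem_univ y)
    have hcardU : (Finset.univ : Finset (Fin B' → Fin (S N + 1) → Bool)).card =
        2 ^ ((S N + 1) * B') := by
      simp only [Finset.card_univ, Fintype.card_fun, Fintype.card_bool, Fintype.card_fin, pow_mul]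
    rw [hcardU] at hcount
    exact hcount
  · -- mixed words over `T` are accepted
    intro f hf
    have hfW : ∀ i, f i ∈ W := fun i => hTW (hf i)
    -- on `T` the boundary states agree
    have hagree : ∀ v ∈ T, ∀ w ∈ T, ∀ j < B', q (j + 1) v = q (j + 1) w := by
      intro v hv w hw j hj
      have e :=
        congr_fun ((Finset.mem_filter.1 hv).2.trans (Finset.mem_filter.1 hw).2.symm) ⟨j, hj⟩
      rw [hσ, hσ] at e
      exact Kannan.code_injective (hq_len _ _) (hq_len _ _) e
    -- reading the first `|ws| + 1 ≤ B' + 1` blocks of a mixed word over `T`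
    have hrun : ∀ (ws : List (List Bool)) (w : List Bool), (∀ v ∈ ws, v ∈ T) → w ∈ T →
        ws.length + 1 ≤ B' + 1 →
        A.runFrom N (A.init N) (ws ++ [w]).flatten = q (ws.length + 1) w := by
      intro ws
      induction ws using List.reverseRecOn with
      | nil =>
        intro w _ _ _
        rw [hq]
        simp
      | append_singleton ws v ih =>
        intro w hws hw hlen
        simp only [List.length_append, List.length_singleton] at hlen ⊢
        have hv : v ∈ T := hws v (by simp)
        rw [List.flatten_append, runFrom_append,
          ih v (fun u hu => hws u (by simp [hu])) hv (by omega),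
          hagree v hv w hw ws.length (by omega), List.flatten_singleton, ← hq_succ]
    have hofFn :
        List.ofFn f = List.ofFn (fun i : Fin B' => f i.castSucc) ++ [f (Fin.last B')] := by
      rw [List.ofFn_succ', List.concat_eq_append]
    have hstate : A.runFrom N (A.init N) (List.ofFn f).flatten = q (B' + 1) (f (Fin.last B')) := by
      rw [hofFn, hrun _ _ (List.forall_mem_ofFn_iff.2 fun j => hf _) (hf _) (by simp),
        List.length_ofFn]
    -- both the mixed word and the constant word `w_{B'}^{B'+1}` have length `N`
    have hlenx : (List.ofFn f).flatten.length = N := by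
      rw [length_flatten_of_forall_length_eq _
          (List.forall_mem_ofFn_iff.2 fun j => hW _ (hfW j)), List.length_ofFn, hN]
    have hlenc : (List.replicate (B' + 1) (f (Fin.last B'))).flatten.length = N := by
      have h : ∀ v ∈ List.replicate (B' + 1) (f (Fin.last B')), v.length = ℓ := fun v hv => by
        rw [List.eq_of_mem_replicate hv]
        exact hW _ (hfW _)
      rw [length_flatten_of_forall_length_eq _ h, List.length_replicate, hN]
    -- the constant word is accepted, hence so is the mixed word (same length, same final state)
    have hacc : A.Accepts (List.replicate (B' + 1) (f (Fin.last B'))).flatten :=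
      (hL _).2 (hconst _ (hfW _))
    refine (hL _).1 ?_
    simp only [StreamingAlgorithm.Accepts, StreamingAlgorithm.finalState] at hacc ⊢
    rw [hlenx, hstate]
    rw [hlenc, ← hq] at hacc
    exact hacc

end Summit.PneNP.PneNP.Theorems.UniformStreamLB.Birth

end
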